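import Summits.BirchSwinnertonDyer.BirchSwinnertonDyer.Theorems.ResidualThetaTransportAtTwoResidualSignedLambdaLowerCMAtTwoDeepHalfAwayTwoTowerPow
import Summits.BirchSwinnertonDyer.BirchSwinnertonDyer.Theorems.ResidualThetaTransportAtTwoResidualSignedLambdaLowerCMAtTwoDeepHalfAwayTwoCharacterReadback
import Summits.BirchSwinnertonDyer.BirchSwinnertonDyer.Theorems.ResidualThetaTransportAtTwoResidualSignedLambdaLowerCMAtTwoCosetFrameOdd
import Summits.BirchSwinnertonDyer.BirchSwinnertonDyer.Theorems.ResidualThetaTransportAtTwoResidualSignedLambdaLowerCMAtTwoCofreeTorsionIncl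
import Summits.BirchSwinnertonDyer.BirchSwinnertonDyer.Theorems.ResidualThetaTransportAtTwoResidualSignedLambdaLowerCMAtTwoRhoLayerPairingGlueAwayTwo
import Summits.BirchSwinnertonDyer.BirchSwinnertonDyer.Theorems.ResidualThetaTransportAtTwoResidualSignedLambdaLowerCMAtTwoDeepHalfAwayTwoTowerCores
import Literature.NumberTheory.GaloisRepresentations.ContinuousShapiroLiftMackeyH1Equiv
import HarnessLib

/-!
# (T1) of S4₀: the character-built local classes are `[2]`-compatible — the hypothesis `hT1` of
# `AwayAssembly.exists_iwasawaH1_locdS_eq_of_towerCompat` (p704576), in the S₀-frame (`p = 2`)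

Route `ResidualThetaTransportAtTwo` (RTT), crux RSL_g `ResidualSignedLambdaLowerCMAtTwo` (stmt-BirchSwinnertonDyer-22608), stub S4₀ `stub_deepHalfAwayTwo`;
seat `prover-bsd-wall-tp2-p2x` g19 (`--supports 22608 --as helper`, closes nothing). THEOREMS ONLY (no definition, no named fact, no instance,
no notation, no `sorry`). BSD is not proved by any of this; RSL_g is not proved here. Sequel of `…DeepHalfAwayTwoTowerPow` (the mixed projection
formula `(⟨[p]_* b', y⟩_{n,p^k}).val • p^{-k} = (⟨b', ι_* y⟩_{n,p^{k+1}}).val • p^{-(k+1)}`, generic `p`), instantiated with the inclusion `cofreeTorsionIncl`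
(p705712) and `muLocalIncl`.

* §4 `jAway_cofreeTorsionIncl` — `j_{n,k+1} ∘ ι_* = j_{n,k}` on `H¹(U_{n,w}, A_ρ[2^k]|)`.
* §5 `cohomologyMap_pow_eq_of_characters` — layer classes reading ONE character of `D_w` at levels `2^{k+1}`, `2^k` are `[2]`-compatible (uniqueness
  `existsUnique_dlev_of_character`, p701888).
* §6 `bijective_frame_of_le` — the Mackey frame below the splitting level (`n ≤ n_w`: every `gΓ_n` is its own `Γ_w`-orbit).
* §7 **`cohomologyMap_eq_of_characters_of_pow`** (abstract `[2]`-morphism; Mackey injectivity in `ext` form = `AwayTowerCores.eq_of_forall_component_eq`)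
  and **`cohomologyMap_coindPow_eq_of_characters`** — THE HYPOTHESIS `hT1` of p704576 verbatim (all `n`).

References: [NeukirchSchmidtWingberg2008] I §5 (1.5.6)–(1.5.7), I §6 (1.6.4); [PerrinRiou1994Invent] §3.6.1; [Kato2004Asterisque] §13.8 (p. 228);
[SerreGaloisCohomology1997] I §2.2; [Washington1997] §13.1; [MilneADT2006] Ch. I Cor. 2.3.
-/

set_option autoImplicit false
-- the Theorems namespace of this sub repeats the summit name by design (D-0017 nested layout)
set_option linter.dupNamespace false

noncomputable section

open scoped Classical

namespace Summit.BirchSwinnertonDyer.BirchSwinnertonDyer.Theorems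

namespace ThetaTransport.AwayTowerPow

open CategoryTheory Function Field NumberField IsDedekindDomain
  Literature.NumberTheory.EllipticCurves Literature.NumberTheory.EllipticCurves.CyclotomicLayer
  Literature.NumberTheory.EllipticCurves.GreenbergSelmer
  Literature.NumberTheory.GaloisRepresentations Literature.NumberTheory.GaloisRepresentations.DiscreteGaloisModule
  Literature.NumberTheory.GaloisCohomology ZpExtension Literature.AnabelianGeometry.AbsoluteAnabelian

/-! ## §4 `j_{n,k+1} ∘ ι_* = j_{n,k}` on `H¹(U_{n,w}, A_ρ[2^k]|)` (the S₀-frame, `p = 2`, `d = 2`) -/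

section Two

open ThetaTransport.AwayCharacterReadback ContinuousCohomology Summit.BirchSwinnertonDyer.BirchSwinnertonDyer.Theorems.OnePair

variable (S : Set (PadicAlgCl 2)) (ρ : FramedGaloisRep ℚ ↥(padicCoeffIntegers S) 2)

set_option maxHeartbeats 1600000 in
/-- **`j_{n,k+1}(ι_* y) = j_{n,k}(y)`**: both are `A_ρ[2^k] ↪ A_ρ` applied to `y|_{U_∞}` (`(A_ρ[2^{k+1}] ↪ A_ρ) ∘ ι = (A_ρ[2^k] ↪ A_ρ)`,
`cofreeTorsionLocalInclusion_cofreeTorsionLocalIncl`), on cocycles. [cite: SerreGaloisCohomology1997, I §2.2 Prop. 8] -/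
theorem jAway_cofreeTorsionIncl (κ : ZpExtension ℚ 2) (w : HeightOneSpectrum (𝓞 ℚ)) (n k : ℕ) (y : Dlev S κ ρ w n k) :
    jAway S κ ρ w n (k + 1)
        (cohomologyMap (subgroupRepMap (Y := localRepOf (cofreeTorsionGaloisModule S ρ ((2 ^ (k + 1) : ℕ) : ℤ)) w)
          (TopRep.ofHom ((cofreeTorsionIncl S ρ k).hom.restrictField (w.adicCompletion ℚ))) (layerGroup κ w n)) 1 y) =
      jAway S κ ρ w n k y := by
  obtain ⟨φ, rfl⟩ := oneCocycleClass_surjective _ y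
  rw [jAway_apply, jAway_apply, cohomologyMap_oneCocycleClass, resLe_oneCocycleClass, resLe_oneCocycleClass,
    cohomologyMap_oneCocycleClass, cohomologyMap_oneCocycleClass]
  refine congrArg _ (Subtype.ext (ContinuousMap.ext fun g => ?_))
  exact cofreeTorsionLocalInclusion_cofreeTorsionLocalIncl S ρ k w _

variable
  (ePk : ∀ k : ℕ, ↥(AddSubgroup.torsionBy (Cofree ρ ↥(padicCoeffField S)) ((2 ^ k : ℕ) : ℤ)) →
    ↥(AddSubgroup.torsionBy (Cofree ρ ↥(padicCoeffField S)) ((2 ^ k : ℕ) : ℤ)) → AlgebraicClosure ℚ)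
  (hμPk : ∀ k a b, ePk k a b ^ (2 ^ k) = 1)
  (hadd₁Pk : ∀ k a₁ a₂ b, ePk k (a₁ + a₂) b = ePk k a₁ b * ePk k a₂ b)
  (hadd₂Pk : ∀ k a b₁ b₂, ePk k a (b₁ + b₂) = ePk k a b₁ * ePk k a b₂)
  (hgalPk : ∀ k (σ : absoluteGaloisGroup ℚ) (a b : ↥(AddSubgroup.torsionBy (Cofree ρ ↥(padicCoeffField S)) ((2 ^ k : ℕ) : ℤ))),
    σ • ePk k a b = ePk k (cofreeTorsionGaloisModule S ρ _ σ a) (cofreeTorsionGaloisModule S ρ _ σ b))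
  (hnondeg : ∀ k T, (∀ a, ePk k a T = 1) → T = 0)
  (htower : ∀ k (a b : ↥(AddSubgroup.torsionBy (Cofree ρ ↥(padicCoeffField S)) ((2 ^ (k + 1) : ℕ) : ℤ))),
    ePk k ((cofreeTorsionPow S ρ k).hom a) ((cofreeTorsionPow S ρ k).hom b) = ePk (k + 1) a b ^ 2)
  (κ : ZpExtension ℚ 2) (hκ : κ.IsCyclotomic) (w : HeightOneSpectrum (𝓞 ℚ)) (hw : ((2 : ℕ) : 𝓞 ℚ) ∉ w.asIdeal)

/-! ## §5 The layer classes read from ONE character at the two levels are `[2]`-compatible -/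

include hnondeg htower in
set_option maxHeartbeats 1600000 in
/-- **`[2]_* b₁(c) = b₀(c)`**: if `b₁(c) ∈ H¹(U_n, A_ρ[2^{k+1}]|)` and `b₀(c) ∈ H¹(U_n, A_ρ[2^k]|)` both read the character `χ_c` of `D_w`
(through `j_{n,k+1}`, resp. `j_{n,k}`, value currency), then `[2]_* b₁(c) = b₀(c)` — uniqueness in `existsUnique_dlev_of_character` (p701888),
the mixed projection formula §3 and §4. [cite: PerrinRiou1994Invent, §3.6.1] [cite: MilneADT2006, Ch. I Cor. 2.3] -/
theorem cohomologyMap_pow_eq_of_characters [CompactSpace (absoluteGaloisGroup ℚ)]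
    [CompactSpace (absoluteGaloisGroup (w.adicCompletion ℚ))] (n k : ℕ) [Fintype (absoluteGaloisGroup ℚ ⧸ κ.layerSubgroup n)]
    [Finite ↥(AddSubgroup.torsionBy (Cofree ρ ↥(padicCoeffField S)) ((2 ^ k : ℕ) : ℤ))]
    (χ : Cosets κ w → CharacterModule (Dloc S κ ρ w))
    (b₁ : Cosets κ w → Dlev S κ ρ w n (k + 1)) (b₀ : Cosets κ w → Dlev S κ ρ w n k)
    (hb₁ : ∀ (c : Cosets κ w) (y : Dlev S κ ρ w n (k + 1)),
      χ c (jAway S κ ρ w n (k + 1) y) =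
        (layerPairingH1Of (cofreeTorsionGaloisModule S ρ ((2 ^ (k + 1) : ℕ) : ℤ)) (2 ^ (k + 1)) (ePk (k + 1)) (hμPk (k + 1))
            (hadd₁Pk (k + 1)) (hadd₂Pk (k + 1)) (hgalPk (k + 1)) κ w n (b₁ c) y).val • ((((2 : ℚ) ^ (k + 1))⁻¹ : ℚ) : AddCircle (1 : ℚ)))
    (hb₀ : ∀ (c : Cosets κ w) (y : Dlev S κ ρ w n k),
      χ c (jAway S κ ρ w n k y) =
        (layerPairingH1Of (cofreeTorsionGaloisModule S ρ ((2 ^ k : ℕ) : ℤ)) (2 ^ k) (ePk k) (hμPk k) (hadd₁Pk k) (hadd₂Pk k) (hgalPk k)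
            κ w n (b₀ c) y).val • ((((2 : ℚ) ^ k)⁻¹ : ℚ) : AddCircle (1 : ℚ)))
    (c : Cosets κ w) :
    cohomologyMap (subgroupRepMap (cofreeTorsionLocalPow S ρ k w) (layerGroup κ w n)) 1 (b₁ c) = b₀ c := by
  haveI : NeZero (2 ^ k) := ⟨pow_ne_zero k two_ne_zero⟩
  haveI : NeZero (2 ^ (k + 1)) := ⟨pow_ne_zero (k + 1) two_ne_zero⟩
  have e2 : ((2 : ℕ) : ℚ) = (2 : ℚ) := rfl
  refine (existsUnique_dlev_of_character S ρ ePk hμPk hadd₁Pk hadd₂Pk hgalPk hnondeg κ w n k (χ c)).unique (fun y => ?_) (hb₀ c)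
  have key := layerPairingH1Of_pow_incl_val_smul S ρ ePk hμPk hadd₁Pk hadd₂Pk hgalPk htower k (cofreeTorsionIncl S ρ k)
    (coe_cofreeTorsionIncl_apply S ρ k) w (muLocalIncl k w) (muVal_muLocalIncl k w) κ n (b₁ c) y
  rw [e2] at key
  rw [key, ← hb₁ c, jAway_cofreeTorsionIncl]

/-! ## §6 The Mackey frame below the splitting level: for `n ≤ n_w` the decomposition group acts trivially on `Γ ⧸ Γ_n` -/

include hκ hw in
/-- For `n ≤ n_w` (`Γ_w ⊆ Γ_{n_w} ⊆ Γ_n`), `U_n = Γ_w` and `(g, y') ↦ ē(y')·g` is a bijection `(Γ ⧸ Γ_n) × (Γ_w ⧸ U_n) ≃ Γ ⧸ Γ_n`: every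
`gΓ_n` is its own double coset. [cite: Washington1997, §13.1] [cite: NeukirchSchmidtWingberg2008, I §5 (1.5.6)–(1.5.7)] -/
theorem bijective_frame_of_le {n : ℕ} (hn : n ≤ nfl w) :
    Function.Bijective fun q : (absoluteGaloisGroup ℚ ⧸ κ.layerSubgroup n) × (absoluteGaloisGroup (w.adicCompletion ℚ) ⧸ layerGroup κ w n) =>
      quotientMapOfHom (κ.layerSubgroup n) (resGalOfEmb (closureEmb (K := ℚ) (w.adicCompletion ℚ))) q.2 * q.1 := by
  have h1 : ∀ y : absoluteGaloisGroup (w.adicCompletion ℚ) ⧸ layerGroup κ w n,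
      quotientMapOfHom (κ.layerSubgroup n) (resGalOfEmb (closureEmb (K := ℚ) (w.adicCompletion ℚ))) y = 1 := fun y => by
    induction y using QuotientGroup.induction_on with
    | H d =>
      exact (QuotientGroup.eq_one_iff
        ((resGalOfEmb (closureEmb (K := ℚ) (w.adicCompletion ℚ)) d : absoluteGaloisGroup ℚ))).mpr
        (CosetFrame.resGalOfEmb_mem_layerSubgroup_of_le κ hκ w hw hn d)
  have h2 : ∀ y y' : absoluteGaloisGroup (w.adicCompletion ℚ) ⧸ layerGroup κ w n, y = y' := fun y y' => by
    induction y using QuotientGroup.induction_on with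
    | H a =>
      induction y' using QuotientGroup.induction_on with
      | H b => exact QuotientGroup.eq.mpr (CosetFrame.resGalOfEmb_mem_layerSubgroup_of_le κ hκ w hw hn (a⁻¹ * b))
  refine ⟨fun q q' h => Prod.ext ?_ (h2 _ _), fun g =>
    ⟨(g, ((1 : absoluteGaloisGroup (w.adicCompletion ℚ)) : absoluteGaloisGroup (w.adicCompletion ℚ) ⧸ layerGroup κ w n)),
      by simp only [h1, one_mul]⟩⟩
  simpa only [h1, one_mul] using h

/-! ## §7 (T1): the character-built LOCAL classes are `[2]`-compatible — the hypothesis `hT1` of p704576 -/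

include hnondeg htower hκ hw in
set_option maxHeartbeats 1600000 in
/-- **(T1), abstract form.** For ANY morphism `P : Maps(Γ ⧸ Γ_n, A_ρ[2^{k+1}])|_{Γ_w} ⟶ Maps(Γ ⧸ Γ_n, A_ρ[2^k])|_{Γ_w}` acting as `[2]` on values
(`hP`): if `t₁`, `t₀` have Mackey components `Φ_{σ_cΓ_n}(t₁) = Sh(b₁ c)`, `Φ_{σ_cΓ_n}(t₀) = Sh(b₀ c)` (`c ∈ Γ ⧸ Γ_{n_w}`, `σ_c = c.out`) with `b₁(c)`,
`b₀(c)` reading the SAME character `χ_c` of `D_w` at levels `2^{k+1}`, `2^k`, then `P_* t₁ = t₀`: componentwise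
`Φ_{σ_c}(P_* t₁) = [2]_* Φ_{σ_c}(t₁) = [2]_* Sh(b₁ c) = Sh([2]_* b₁ c) = Sh(b₀ c) = Φ_{σ_c}(t₀)` (§5, `shapiroLift_cohomologyMap`), and the components
detect classes (Mackey injectivity over the frame `CosetFrame.bijective_cosets_out` for `n ≥ n_w`, §6 for `n ≤ n_w`).
[cite: NeukirchSchmidtWingberg2008, I §5 (1.5.6)–(1.5.7), I §6 (1.6.4)] [cite: PerrinRiou1994Invent, §3.6.1] [cite: Kato2004Asterisque, §13.8 (p. 228)] -/
theorem cohomologyMap_eq_of_characters_of_pow [CompactSpace (absoluteGaloisGroup ℚ)]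
    [CompactSpace (absoluteGaloisGroup (w.adicCompletion ℚ))] (n k : ℕ) [Fintype (absoluteGaloisGroup ℚ ⧸ κ.layerSubgroup n)]
    [Finite ↥(AddSubgroup.torsionBy (Cofree ρ ↥(padicCoeffField S)) ((2 ^ k : ℕ) : ℤ))]
    (χ : Cosets κ w → CharacterModule (Dloc S κ ρ w))
    (P : TopRep.res (resGalOfEmb (closureEmb (K := ℚ) (w.adicCompletion ℚ)) :
          absoluteGaloisGroup (w.adicCompletion ℚ) →* absoluteGaloisGroup ℚ)
        (coindFin (cofreeTorsionGaloisModule S ρ ((2 ^ (k + 1) : ℕ) : ℤ)).toTopRep (κ.layerSubgroup n)) ⟶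
      TopRep.res (resGalOfEmb (closureEmb (K := ℚ) (w.adicCompletion ℚ)) :
          absoluteGaloisGroup (w.adicCompletion ℚ) →* absoluteGaloisGroup ℚ)
        (coindFin (cofreeTorsionGaloisModule S ρ ((2 ^ k : ℕ) : ℤ)).toTopRep (κ.layerSubgroup n)))
    (hP : ∀ (F : coindFin (cofreeTorsionGaloisModule S ρ ((2 ^ (k + 1) : ℕ) : ℤ)).toTopRep (κ.layerSubgroup n))
      (y : absoluteGaloisGroup ℚ ⧸ κ.layerSubgroup n), P.hom F y = (cofreeTorsionPow S ρ k).hom (F y))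
    (b₁ : Cosets κ w → Dlev S κ ρ w n (k + 1))
    (t₁ : continuousCohomology 1 (TopRep.res (resGalOfEmb (closureEmb (K := ℚ) (w.adicCompletion ℚ)) :
        absoluteGaloisGroup (w.adicCompletion ℚ) →* absoluteGaloisGroup ℚ)
      (coindFin (cofreeTorsionGaloisModule S ρ ((2 ^ (k + 1) : ℕ) : ℤ)).toTopRep (κ.layerSubgroup n))))
    (b₀ : Cosets κ w → Dlev S κ ρ w n k)
    (t₀ : continuousCohomology 1 (TopRep.res (resGalOfEmb (closureEmb (K := ℚ) (w.adicCompletion ℚ)) :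
        absoluteGaloisGroup (w.adicCompletion ℚ) →* absoluteGaloisGroup ℚ)
      (coindFin (cofreeTorsionGaloisModule S ρ ((2 ^ k : ℕ) : ℤ)).toTopRep (κ.layerSubgroup n))))
    (hb₁ : ∀ (c : Cosets κ w) (y : Dlev S κ ρ w n (k + 1)),
      χ c (jAway S κ ρ w n (k + 1) y) =
        (layerPairingH1Of (cofreeTorsionGaloisModule S ρ ((2 ^ (k + 1) : ℕ) : ℤ)) (2 ^ (k + 1)) (ePk (k + 1)) (hμPk (k + 1))
            (hadd₁Pk (k + 1)) (hadd₂Pk (k + 1)) (hgalPk (k + 1)) κ w n (b₁ c) y).val • ((((2 : ℚ) ^ (k + 1))⁻¹ : ℚ) : AddCircle (1 : ℚ)))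
    (hu₁ : ∀ c : Cosets κ w,
      cohomologyMap (resCoindFinHomR (cofreeTorsionGaloisModule S ρ ((2 ^ (k + 1) : ℕ) : ℤ)).toTopRep (κ.layerSubgroup n)
          (resGalOfEmb (closureEmb (K := ℚ) (w.adicCompletion ℚ)))
          (c.out : absoluteGaloisGroup ℚ ⧸ κ.layerSubgroup n)) 1 t₁ =
        layerShapiroOf (cofreeTorsionGaloisModule S ρ ((2 ^ (k + 1) : ℕ) : ℤ)) κ w n (b₁ c))
    (hb₀ : ∀ (c : Cosets κ w) (y : Dlev S κ ρ w n k),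
      χ c (jAway S κ ρ w n k y) =
        (layerPairingH1Of (cofreeTorsionGaloisModule S ρ ((2 ^ k : ℕ) : ℤ)) (2 ^ k) (ePk k) (hμPk k) (hadd₁Pk k) (hadd₂Pk k) (hgalPk k)
            κ w n (b₀ c) y).val • ((((2 : ℚ) ^ k)⁻¹ : ℚ) : AddCircle (1 : ℚ)))
    (hu₀ : ∀ c : Cosets κ w,
      cohomologyMap (resCoindFinHomR (cofreeTorsionGaloisModule S ρ ((2 ^ k : ℕ) : ℤ)).toTopRep (κ.layerSubgroup n)
          (resGalOfEmb (closureEmb (K := ℚ) (w.adicCompletion ℚ)))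
          (c.out : absoluteGaloisGroup ℚ ⧸ κ.layerSubgroup n)) 1 t₀ =
        layerShapiroOf (cofreeTorsionGaloisModule S ρ ((2 ^ k : ℕ) : ℤ)) κ w n (b₀ c)) :
    cohomologyMap P 1 t₁ = t₀ := by
  haveI : NeZero (2 ^ k) := ⟨pow_ne_zero k two_ne_zero⟩
  haveI : NeZero (2 ^ (k + 1)) := ⟨pow_ne_zero (k + 1) two_ne_zero⟩
  -- (i) the layer classes are `[2]`-compatible (§5)
  have hbb := cohomologyMap_pow_eq_of_characters S ρ ePk hμPk hadd₁Pk hadd₂Pk hgalPk hnondeg htower κ w n k χ b₁ b₀ hb₁ hb₀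
  -- (ii) the Mackey components commute with `P` / `[2]`
  have hcomp : ∀ g : absoluteGaloisGroup ℚ ⧸ κ.layerSubgroup n,
      cohomologyMap (resCoindFinHomR (cofreeTorsionGaloisModule S ρ ((2 ^ k : ℕ) : ℤ)).toTopRep (κ.layerSubgroup n)
          (resGalOfEmb (closureEmb (K := ℚ) (w.adicCompletion ℚ))) g) 1 (cohomologyMap P 1 t₁) =
        cohomologyMap (coindFinMap (cofreeTorsionLocalPow S ρ k w) (layerGroup κ w n)) 1
          (cohomologyMap (resCoindFinHomR (cofreeTorsionGaloisModule S ρ ((2 ^ (k + 1) : ℕ) : ℤ)).toTopRep (κ.layerSubgroup n)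
            (resGalOfEmb (closureEmb (K := ℚ) (w.adicCompletion ℚ))) g) 1 t₁) := fun g => by
    have h1 := map_comp_apply_of (ContinuousMonoidHom.id _) (ContinuousMonoidHom.id _) (ContinuousMonoidHom.id _) (fun _ => rfl)
      (resIdHom P)
      (resIdHom (resCoindFinHomR (cofreeTorsionGaloisModule S ρ ((2 ^ k : ℕ) : ℤ)).toTopRep (κ.layerSubgroup n)
        (resGalOfEmb (closureEmb (K := ℚ) (w.adicCompletion ℚ))) g))
      (resIdHom (P ≫ resCoindFinHomR (cofreeTorsionGaloisModule S ρ ((2 ^ k : ℕ) : ℤ)).toTopRep (κ.layerSubgroup n)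
        (resGalOfEmb (closureEmb (K := ℚ) (w.adicCompletion ℚ))) g))
      (fun _ => rfl) 1 t₁
    have h2 := map_comp_apply_of (ContinuousMonoidHom.id _) (ContinuousMonoidHom.id _) (ContinuousMonoidHom.id _) (fun _ => rfl)
      (resIdHom (resCoindFinHomR (cofreeTorsionGaloisModule S ρ ((2 ^ (k + 1) : ℕ) : ℤ)).toTopRep (κ.layerSubgroup n)
        (resGalOfEmb (closureEmb (K := ℚ) (w.adicCompletion ℚ))) g))
      (resIdHom (coindFinMap (cofreeTorsionLocalPow S ρ k w) (layerGroup κ w n)))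
      (resIdHom (P ≫ resCoindFinHomR (cofreeTorsionGaloisModule S ρ ((2 ^ k : ℕ) : ℤ)).toTopRep (κ.layerSubgroup n)
        (resGalOfEmb (closureEmb (K := ℚ) (w.adicCompletion ℚ))) g))
      (fun F => funext fun y' => hP _ _) 1 t₁
    exact h1.symm.trans h2
  -- (iii) Shapiro is natural in the coefficients
  have hSh : ∀ c : Cosets κ w,
      cohomologyMap (coindFinMap (cofreeTorsionLocalPow S ρ k w) (layerGroup κ w n)) 1
          (layerShapiroOf (cofreeTorsionGaloisModule S ρ ((2 ^ (k + 1) : ℕ) : ℤ)) κ w n (b₁ c)) =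
        layerShapiroOf (cofreeTorsionGaloisModule S ρ ((2 ^ k : ℕ) : ℤ)) κ w n
          (cohomologyMap (subgroupRepMap (cofreeTorsionLocalPow S ρ k w) (layerGroup κ w n)) 1 (b₁ c)) := fun c => by
    unfold layerShapiroOf
    rw [shapiroLift_cohomologyMap]
  -- (iv) components detect classes (Mackey injectivity), over the frame of `n` vs `n_w`
  by_cases hn : nfl w ≤ n
  · refine AwayTowerCores.eq_of_forall_component_eq (cofreeTorsionGaloisModule S ρ ((2 ^ k : ℕ) : ℤ)).toTopRep
      (κ.layerSubgroup n) (resGalOfEmb (closureEmb (K := ℚ) (w.adicCompletion ℚ)))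
      (fun c : Cosets κ w => (c.out : absoluteGaloisGroup ℚ ⧸ κ.layerSubgroup n))
      (CosetFrame.bijective_cosets_out κ hκ w hw hn) _ _ fun c => ?_
    refine (hcomp _).trans ?_
    beta_reduce
    rw [hu₁ c, hu₀ c, hSh c, hbb c]
  · have hn' : n ≤ nfl w := (not_le.mp hn).le
    refine AwayTowerCores.eq_of_forall_component_eq (cofreeTorsionGaloisModule S ρ ((2 ^ k : ℕ) : ℤ)).toTopRep
      (κ.layerSubgroup n) (resGalOfEmb (closureEmb (K := ℚ) (w.adicCompletion ℚ)))
      (fun g : absoluteGaloisGroup ℚ ⧸ κ.layerSubgroup n => g) (bijective_frame_of_le κ hκ w hw hn') _ _ fun g => ?_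
    -- a coset `c ∈ Γ ⧸ Γ_{n_w}` whose representative lies over `g`
    obtain ⟨c, hc⟩ : ∃ c : Cosets κ w, (c.out : absoluteGaloisGroup ℚ ⧸ κ.layerSubgroup n) = g := by
      induction g using QuotientGroup.induction_on with
      | H a =>
        obtain ⟨h, hh⟩ := QuotientGroup.mk_out_eq_mul (κ.layerSubgroup (nfl w)) a
        refine ⟨(a : Cosets κ w), ?_⟩
        rw [hh, QuotientGroup.mk_mul, (QuotientGroup.eq_one_iff (h : absoluteGaloisGroup ℚ)).mpr (κ.layerSubgroup_antitone hn' h.2),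
          mul_one]
    refine (hcomp _).trans ?_
    beta_reduce
    rw [← hc, hu₁ c, hu₀ c, hSh c, hbb c]

include hnondeg htower hκ hw in
set_option maxHeartbeats 1600000 in
/-- **(T1) `H¹([2]|_w)(t₁) = t₀`** — THE HYPOTHESIS `hT1` of `AwayAssembly.exists_iwasawaH1_locdS_eq_of_towerCompat` (p704576), verbatim: the abstract
form applied to the morphism `H¹` of which p697362's `localization_shapiroLift_cofreeTorsionPow` speaks (`[2]` post-composed on `Maps(Γ ⧸ Γ_n, ·)`,
restricted to `Γ_w`). [cite: NeukirchSchmidtWingberg2008, I §5 (1.5.6)–(1.5.7), I §6 (1.6.4)] [cite: PerrinRiou1994Invent, §3.6.1]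
[cite: Kato2004Asterisque, §13.8 (p. 228)] -/
theorem cohomologyMap_coindPow_eq_of_characters [CompactSpace (absoluteGaloisGroup ℚ)]
    [CompactSpace (absoluteGaloisGroup (w.adicCompletion ℚ))] (n k : ℕ) [Fintype (absoluteGaloisGroup ℚ ⧸ κ.layerSubgroup n)]
    [Finite ↥(AddSubgroup.torsionBy (Cofree ρ ↥(padicCoeffField S)) ((2 ^ k : ℕ) : ℤ))]
    (χ : Cosets κ w → CharacterModule (Dloc S κ ρ w))
    (b₁ : Cosets κ w → Dlev S κ ρ w n (k + 1))
    (t₁ : galoisCohomology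
      (((cofreeTorsionGaloisModule S ρ ((2 ^ (k + 1) : ℕ) : ℤ)).coind (κ.layerSubgroup n) (κ.isOpen_layerSubgroup n)).toLocal
        (Sum.inr w)) 1)
    (b₀ : Cosets κ w → Dlev S κ ρ w n k)
    (t₀ : galoisCohomology
      (((cofreeTorsionGaloisModule S ρ ((2 ^ k : ℕ) : ℤ)).coind (κ.layerSubgroup n) (κ.isOpen_layerSubgroup n)).toLocal
        (Sum.inr w)) 1)
    (hb₁ : ∀ (c : Cosets κ w) (y : Dlev S κ ρ w n (k + 1)),
      χ c (jAway S κ ρ w n (k + 1) y) =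
        (layerPairingH1Of (cofreeTorsionGaloisModule S ρ ((2 ^ (k + 1) : ℕ) : ℤ)) (2 ^ (k + 1)) (ePk (k + 1)) (hμPk (k + 1))
            (hadd₁Pk (k + 1)) (hadd₂Pk (k + 1)) (hgalPk (k + 1)) κ w n (b₁ c) y).val • ((((2 : ℚ) ^ (k + 1))⁻¹ : ℚ) : AddCircle (1 : ℚ)))
    (hu₁ : ∀ c : Cosets κ w,
      cohomologyMap (resCoindFinHomR (cofreeTorsionGaloisModule S ρ ((2 ^ (k + 1) : ℕ) : ℤ)).toTopRep (κ.layerSubgroup n)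
          (resGalOfEmb (closureEmb (K := ℚ) (w.adicCompletion ℚ)))
          (c.out : absoluteGaloisGroup ℚ ⧸ κ.layerSubgroup n)) 1 t₁ =
        layerShapiroOf (cofreeTorsionGaloisModule S ρ ((2 ^ (k + 1) : ℕ) : ℤ)) κ w n (b₁ c))
    (hb₀ : ∀ (c : Cosets κ w) (y : Dlev S κ ρ w n k),
      χ c (jAway S κ ρ w n k y) =
        (layerPairingH1Of (cofreeTorsionGaloisModule S ρ ((2 ^ k : ℕ) : ℤ)) (2 ^ k) (ePk k) (hμPk k) (hadd₁Pk k) (hadd₂Pk k) (hgalPk k)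
            κ w n (b₀ c) y).val • ((((2 : ℚ) ^ k)⁻¹ : ℚ) : AddCircle (1 : ℚ)))
    (hu₀ : ∀ c : Cosets κ w,
      cohomologyMap (resCoindFinHomR (cofreeTorsionGaloisModule S ρ ((2 ^ k : ℕ) : ℤ)).toTopRep (κ.layerSubgroup n)
          (resGalOfEmb (closureEmb (K := ℚ) (w.adicCompletion ℚ)))
          (c.out : absoluteGaloisGroup ℚ ⧸ κ.layerSubgroup n)) 1 t₀ =
        layerShapiroOf (cofreeTorsionGaloisModule S ρ ((2 ^ k : ℕ) : ℤ)) κ w n (b₀ c)) :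
    cohomologyMap (TopRep.ofHom ⟨(coindFinMap (cofreeTorsionPow S ρ k) (κ.layerSubgroup n)).hom.toContinuousLinearMap, fun δ =>
        (coindFinMap (cofreeTorsionPow S ρ k) (κ.layerSubgroup n)).hom.isIntertwining'
          (resGalOfEmb (closureEmb (K := ℚ) (w.adicCompletion ℚ)) δ)⟩ :
      (((cofreeTorsionGaloisModule S ρ ((2 ^ (k + 1) : ℕ) : ℤ)).coind (κ.layerSubgroup n) (κ.isOpen_layerSubgroup n)).toLocal
          (Sum.inr w)).toTopRep ⟶
        (((cofreeTorsionGaloisModule S ρ ((2 ^ k : ℕ) : ℤ)).coind (κ.layerSubgroup n) (κ.isOpen_layerSubgroup n)).toLocal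
          (Sum.inr w)).toTopRep) 1 t₁ = t₀ :=
  cohomologyMap_eq_of_characters_of_pow S ρ ePk hμPk hadd₁Pk hadd₂Pk hgalPk hnondeg htower κ hκ w hw n k χ _ (fun _ _ => rfl)
    b₁ t₁ b₀ t₀ hb₁ hu₁ hb₀ hu₀

end Two

end ThetaTransport.AwayTowerPow

end Summit.BirchSwinnertonDyer.BirchSwinnertonDyer.Theorems

end
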